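import Summits.HodgeConjecture.HodgeConjecture.Theorems.MarkmanPartnerTransportK3Sq2SquareTransportAlongCorrespondence
import Summits.HodgeConjecture.HodgeConjecture.Theorems.MarkmanPartnerTransportPartnerTransportIsometry
import Summits.HodgeConjecture.HodgeConjecture.Theorems.MarkmanPartnerTransportKugaSatakeSimilitudeVarescoFree
import Literature.AlgebraicGeometry.Hyperkaehler.K3HilbertSquareIncidence
import Literature.AlgebraicGeometry.Hyperkaehler.MarkmanRationalHodgeIsometries
import Summits.HodgeConjecture.HodgeConjecture.Theses.MarkmanPartnerTransport

/-!
# Route MarkmanPartnerTransport · support #2 `PartnerTransport` (stmt-HodgeConjecture-19650) BY NAME from Markman's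
# `H²`-ISOMETRY theorem and Beauville's incidence ALONE (no blow-up ∕ double-cover descent, no total-cohomology lift)

A third proof route for `PartnerTransport`, through the transport-along-any-correspondence theorem
`KugaSatakeMixed.hodgeConjectureFor_of_square_of_algebraicCorrespondence` (`…K3Sq2SquareTransportAlongCorrespondence`):
the ONE algebraic correspondence `S → X` non-zero on the period is `[Z_f]_* ∘ [θ]_*`, where `θ ⊂ H × S` is
Beauville's incidence of the marked Hilbert square `H = S^{[2]}` (`Beauville1983_hilbertSquare_markedIncidence`),
`f : H²(H) ⥲ H²(X)` the marked rational Hodge isometry obtained from the partner datum by Witt extension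
(`exists_markedHodgeIsometry_of_partner`, a tree theorem; Voisin's cup-product input discharged by the tree theorem
`Theorems.Voisin2003_cupProduct_algebraicClasses_holds`) and `Z_f ∈ A⁴(X × H)` Markman's algebraic class with
`[Z_f]_* = f` (`Markman2024_rationalHodgeIsometry_algebraic_marked`, Markman 2024 Thm. 1.1 in its `H²` form).

* `hodgeConjectureFor_of_square_of_partner_of_markmanIsometry` — HC⁴(S ⊗ S) ⇒ HC⁴(X) for the partner datum, modulo
  {Beauville incidence, Markman `H²`-isometry, Charles–Markman, Verbitsky–Guan, O'Grady};
* `partnerTransport_of_markmanIsometry` — `Theses.MarkmanPartnerTransport.PartnerTransport` BY NAME modulo the same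
  five records. Compared with `PartnerLattice.partnerTransport_of_facts` (modulo {Beauville incidence, Beauville ∕
  Fogarty blow-up surjection, Markman's TOTAL-COHOMOLOGY LIFT `Markman2024_rationalHodgeIsometry_lift_algebraic_marked`,
  Voisin cup}) the blow-up ∕ surjective-descent step `HC⁴(S × S) ⇒ HC⁴(S^{[2]})` and the total-cohomology lift are NOT
  used: only the `H²`-statement of Markman's theorem enters, through a single correspondence `S → X`.

CONDITIONAL on the five displayed published records; THEOREMS ONLY; no sorry, no definition, no new named fact; the
item's own signature is unchanged and not closed by this (a conditional result). Prover seat hodge-nonav-19652-p1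
(gen 16), `--supports stmt-HodgeConjecture-19650`.

References: E. Markman, Compos. Math. 160 (2024) §1.1 Thm. 1.1; A. Beauville, J. Differential Geom. 18 (1983) §6
Prop. 6, §9 Lemme 1; J.-P. Serre, *A Course in Arithmetic* IV §1.5; F. Charles, E. Markman, Compos. Math. 149 (2013)
Thm. 1.1; K. O'Grady, Commun. Contemp. Math. 10 (2008) §3; C. Voisin, *Hodge Theory I* Lemma 11.41.
-/

set_option linter.dupNamespace false

noncomputable section

namespace Summit.HodgeConjecture.HodgeConjecture.Theorems.MarkmanPartnerTransport.KugaSatakeMixed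

open CategoryTheory MonoidalCategory Literature.AlgebraicGeometry Literature.AlgebraicGeometry.Motives
open Literature.AlgebraicGeometry.HodgeTheory Literature.AlgebraicTopology.SingularHomology
open Literature.AlgebraicGeometry.Hyperkaehler Literature.AlgebraicGeometry.Surfaces
open Summit.HodgeConjecture.HodgeConjecture.Ring2.AbelianAll
open Summit.HodgeConjecture.HodgeConjecture.Theorems.NikulinTwinTransport
open Summit.HodgeConjecture.HodgeConjecture.Theorems.MarkmanPartnerTransport.KugaSatakeSimilitude
open Summit.HodgeConjecture.HodgeConjecture.Theorems.MarkmanPartnerTransport.PartnerLattice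

variable {S X : SchemeOver ℂ} {φ : complexBetti X 2 ≃ₗ[ℂ] (K3HilbertIndex → ℂ)} {PX : complexBetti X (2 * 4)}
  {z : K3HilbertIndex → ℂ} {η : complexBetti S (2 * 1) ≃ₗ[ℂ] (K3Index → ℂ)} {p : complexBetti S (2 * 2)}
  {x : K3Index → ℂ}

/-- `MarkedK3Sq[X, φ, P, z]`: VERBATIM the `let MarkedK3Sq := …` binder of the route declarations of
MarkmanPartnerTransport (clauses (m1)–(m6)). Local notation only. -/
local notation3 (prettyPrint := false) "MarkedK3Sq[" X ", " φ ", " P ", " z "]" =>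
  (((IsIntegralClass P ∧ ∀ Q : complexBetti X (2 * 4), IsIntegralClass Q → ∃ n : ℤ, Q = n • P) ∧
    (∀ c : complexBetti X 2, IsIntegralClass c ↔ ∃ v : K3HilbertIndex → ℤ, φ c = fun i => (v i : ℂ)) ∧
    (∀ a : complexBetti X 2, cupPowTwo a 4 = ((3 : ℂ) * (k3HilbertForm 2 (φ a) (φ a)) ^ 2) • P) ∧
    (IsOfHodgeType 4 X 2 2 0 (LinearEquiv.symm φ z) ∧
      ∀ τ : complexBetti X 2, IsOfHodgeType 4 X 2 2 0 τ → ∃ t : ℂ, τ = t • LinearEquiv.symm φ z) ∧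
    (∀ c : complexBetti X 2, IsOfHodgeType 4 X 2 1 1 c ↔
      (k3HilbertForm 2 (φ c) z = 0 ∧ k3HilbertForm 2 (φ c) (star z) = 0)) ∧
    (k3HilbertForm 2 z z = 0 ∧ 0 < (k3HilbertForm 2 (star z) z).re)))

/-- `MarkedK3[S, η, p, x]`: VERBATIM the `let MarkedK3 := …` binder of the route declarations
(`PicardThreeK3Squares`, `PartnerTransport`). Local notation only. -/
local notation3 (prettyPrint := false) "MarkedK3[" S ", " η ", " p ", " x "]" =>
  (p ≠ 0 ∧ (IsIntegralClass p ∧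
    (∀ q : complexBetti S (2 * 2), IsIntegralClass q → ∃ n : ℤ, q = n • p) ∧
    (∀ c : complexBetti S (2 * 1), IsIntegralClass c ↔ ∃ v : K3Index → ℤ, η c = fun i => (v i : ℂ)) ∧
    (∀ a b : complexBetti S (2 * 1),
      cupProduct (rfl : 2 * 1 + 2 * 1 = 2 * 2) a b = k3Form (η a) (η b) • p) ∧
    IsOfHodgeType 2 S (2 * 1) 2 0 (LinearEquiv.symm η x) ∧
    (∀ τ : complexBetti S (2 * 1), IsOfHodgeType 2 S (2 * 1) 2 0 τ →
      ∃ t : ℂ, τ = t • LinearEquiv.symm η x)) ∧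
    (k3Form x x = 0 ∧ 0 < (k3Form (star x) x).re ∧
      ∃ u : K3Index → ℤ, k3Form (fun i => (u i : ℂ)) x = 0 ∧ 0 < ∑ i, ∑ j, u i * k3Gram i j * u j))

/-- `Transc[S, y]`: `y` is cup-orthogonal to `N¹(S) = algebraicClasses S 1`. -/
local notation3 (prettyPrint := false) "Transc[" S ", " y "]" =>
  (∀ d ∈ algebraicClasses S 1, cupProduct (rfl : 2 * 1 + 2 * 1 = 2 * 2) y d = 0)

/-- **HC⁴(S ⊗ S) ⇒ HC⁴(X) for a K3 partner `S` of a marked `K3^{[2]}`-type `X`, from Markman's `H²`-isometry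
theorem and Beauville's incidence** (and Charles–Markman, Verbitsky–Guan, O'Grady): the partner clauses (g1), (g2),
(g5) give a marked rational Hodge isometry `f : H²(S^{[2]}) ⥲ H²(X)` (Witt), Markman makes it `[Z_f]_*`, and
`[Z_f]_* ∘ [θ]_*` is an algebraic correspondence `S → X` with `[Z_f]_*[θ]_* σ = f(φ_H⁻¹(x, 0)) ≠ 0`;
`hodgeConjectureFor_of_square_of_algebraicCorrespondence` concludes. CONDITIONAL on the five records; credits nothing
to HC. [cite: Markman2024, §1.1 Thm. 1.1] [cite: Beauville1983, §6 Prop. 6 and §9 Lemme 1]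
[cite: CharlesMarkman2013, Thm. 1.1 (§1)] -/
theorem hodgeConjectureFor_of_square_of_partner_of_markmanIsometry
    (hV : VerbitskyGuan_cohomology_K3HilbertSquareType) (hO : OGrady2008_dualBBFClass_algebraic)
    (hCM : CharlesMarkman2013_lefschetzStandard_K3HilbertType) (hB : Beauville1983_hilbertSquare_markedIncidence)
    (hMk : Markman2024_rationalHodgeIsometry_algebraic_marked)
    (hX : IsSmoothProjective 4 X) (hK : IsOfK3HilbertSquareType X) (hM : MarkedK3Sq[X, φ, PX, z])
    (hS : IsK3Surface S) (hMS : MarkedK3[S, η, p, x]) (g : complexBetti S (2 * 1) →ₗ[ℂ] complexBetti X 2)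
    (hg1 : ∀ a, IsRationalClass a → IsRationalClass (g a))
    (hg2 : ∀ (i j : ℕ) a, IsOfHodgeType 2 S (2 * 1) i j a → IsOfHodgeType 4 X 2 i j (g a))
    (hg5 : ∀ a b, Transc[S, a] → Transc[S, b] → k3HilbertForm 2 (φ (g a)) (φ (g b)) = k3Form (η a) (η b))
    (hHC : HodgeConjectureFor 4 (S ⊗ S)) : HodgeConjectureFor 4 X := by
  have hμ := hasPoincareDuality_complexOrientationFamily
  have hσ0 := marking_symm_ne_zero hMS
  obtain ⟨-, hmk, hxx, hxpos, hu⟩ := hMS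
  have hηint := hmk.2.2.1
  have hcupS := hmk.2.2.2.1
  have h20 := hmk.2.2.2.2.1
  have hline := hmk.2.2.2.2.2
  have hS2 : IsSmoothProjective 2 S := IsK3Surface.isSmoothProjective hS
  -- Beauville's marked Hilbert square with its algebraic incidence
  obtain ⟨H, hH, Ξ, φH, PH, -, hHK, hMH, θ, hθ, hi⟩ := hB complexOrientationFamily hμ S hS η p x hmk hxx hxpos hu
  -- Witt extension to a marked rational Hodge isometry `f : H²(H) ⥲ H²(X)`
  obtain ⟨f, hfbij, hfrat, hfh, hfq⟩ := exists_markedHodgeIsometry_of_partner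
    Theorems.Voisin2003_cupProduct_algebraicClasses_holds hμ hX hM hS hηint hcupS h20 hxpos hH hMH hθ hi hg1 hg2 hg5
  -- Markman: `f = [Z]_*`
  obtain ⟨Z, hZ, hfZ⟩ := hMk complexOrientationFamily hμ H X hH hX hHK hK φH PH (Sum.elim x 0) φ PX z hMH hM f hfbij
    hfrat hfh hfq
  have hfalg : IsAlgebraicCorrespondence 4 4 X H f := by
    rw [show f = corrAction complexOrientationFamily hX hH (rfl : 2 + 2 * 4 = 2 + 2 * 4) Z from LinearMap.ext hfZ]
    exact isAlgebraicCorrespondence_corrAction_complex hX hH _ (by norm_num) hZ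
  -- the composite correspondence `S → X` and its value at the period
  have hθalg : IsAlgebraicCorrespondence 4 2 H S
      (corrAction complexOrientationFamily hH hS2 (rfl : 2 * 1 + 2 * 2 = 2 + 2 * 2) θ) :=
    isAlgebraicCorrespondence_corrAction_complex hH hS2 _ (by norm_num) hθ
  have hΦ : IsAlgebraicCorrespondence 4 2 X S
      (f ∘ₗ corrAction complexOrientationFamily hH hS2 (rfl : 2 * 1 + 2 * 2 = 2 + 2 * 2) θ) :=
    IsAlgebraicCorrespondence.comp hX hH hS2 hθalg hfalg (by norm_num)
  have hθσ : corrAction complexOrientationFamily hH hS2 (rfl : 2 * 1 + 2 * 2 = 2 + 2 * 2) θ (η.symm x) ≠ 0 := by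
    intro h0
    have h1 := hi (η.symm x)
    rw [h0, map_zero, LinearEquiv.apply_symm_apply] at h1
    apply hσ0
    have hx0 : x = 0 := by
      funext i
      have h2 := congrFun h1 (Sum.inl i)
      simpa using h2.symm
    rw [hx0, map_zero]
  have hΦσ : (f ∘ₗ corrAction complexOrientationFamily hH hS2 (rfl : 2 * 1 + 2 * 2 = 2 + 2 * 2) θ) (η.symm x) ≠ 0 := by
    rw [LinearMap.comp_apply]
    exact fun h0 => hθσ (hfbij.1 (by rw [h0, map_zero]))
  exact hodgeConjectureFor_of_square_of_algebraicCorrespondence hV hO hCM hS2 h20 hσ0 hline hX hK hM _ hΦ hΦσ hHC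

/-- **`PartnerTransport` (route MarkmanPartnerTransport, support #2, stmt-HodgeConjecture-19650) BY NAME modulo
{Beauville incidence, Markman `H²`-isometry, Charles–Markman, Verbitsky–Guan, O'Grady}** — a third conditional proof
of the route declaration, through one algebraic correspondence `S → X` and the Schur ∕ subfield transport; neither the
blow-up ∕ double-cover record nor Markman's total-cohomology lift is used. CONDITIONAL on the five published records;
credits nothing to HC. [cite: Markman2024, §1.1 Thm. 1.1] [cite: Beauville1983, §6 Prop. 6 and §9 Lemme 1]
[cite: CharlesMarkman2013, Thm. 1.1 (§1)] -/
theorem partnerTransport_of_markmanIsometry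
    (hV : VerbitskyGuan_cohomology_K3HilbertSquareType) (hO : OGrady2008_dualBBFClass_algebraic)
    (hCM : CharlesMarkman2013_lefschetzStandard_K3HilbertType) (hB : Beauville1983_hilbertSquare_markedIncidence)
    (hMk : Markman2024_rationalHodgeIsometry_algebraic_marked) :
    Summit.HodgeConjecture.HodgeConjecture.Theses.MarkmanPartnerTransport.PartnerTransport := by
  intro X hX hK φ P z hM S hS η p x hMS g hg hHC
  obtain ⟨hg1, hg2, -, -, hg5, -, -⟩ := hg
  exact hodgeConjectureFor_of_square_of_partner_of_markmanIsometry hV hO hCM hB hMk hX hK hM hS hMS g hg1 hg2 hg5 hHC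

end Summit.HodgeConjecture.HodgeConjecture.Theorems.MarkmanPartnerTransport.KugaSatakeMixed

end
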